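import Summits.BirchSwinnertonDyer.BirchSwinnertonDyer.Theses.CumulativeHeegnerLeopoldt
import Summits.BirchSwinnertonDyer.BirchSwinnertonDyer.Theorems.CumulativeHeegnerLeopoldtCumulativeHeegnerInclusionAtThreeSpecialisationValuesTempered
import Summits.BirchSwinnertonDyer.BirchSwinnertonDyer.Theorems.UniversalToricDescentCharIdealVacuity
import Summits.BirchSwinnertonDyer.Rank1Residual.X11b.AnticyclotomicModuleFinite
import HarnessLib

/-!
# Crux K1 `CumulativeHeegnerInclusionAtThree` (stmt-BirchSwinnertonDyer-24198), line `birth`: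
# **PRINT-FREE DOORS into stub A = crux 26896** — A ⟸ IB, A ⟸ IB_off, A ⟸ IB♮, A ⟸ A♮, each WITHOUT the print input P

Lead prover bsd-line-chl-k1-p1 g6 (`--supports stmt-BirchSwinnertonDyer-24198`). The by-name doors of this lineage into
stub A (`TemperedHeegnerInclusionAtThree`, crux stmt-BirchSwinnertonDyer-26896) landed so far —
`…OfIndexBound` (p635774: P → IB → A), `…OfTemperedIndexBound` (p634963: P → IB♮ → A), `…OfTemperedDomination`
(p625563: P → A♮ → K1) — all consume the PRINT input P (`ResidualSelmerPrintedInputAtThree` = CGLS22 Prop. 14 by name),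
and use it for exactly one thing: `X_{∅,0}(𝔭′)` is a TORSION `Λ`-module. For A itself this is unnecessary: OFF the torsion
locus the tree's characteristic ideal is the unit ideal (`UniversalToricDescentCharIdealVacuity.charIdeal_eq_top_of_not_isTorsion`,
the convention audited by the K1 vets: «junk-true off the Λ-torsion locus»), so A's inclusion holds there with `μ = 0`; ON the
torsion locus the landed chains apply verbatim. Hence every door into crux 26896 is print-free:

* `exists_span_pow_mul_le_map_charIdeal_of_torsion_imp` — the algebra of the case split, for any finitely generated
  `Λ`-module `X` and any `L ∈ R₀⟦T⟧`: if, ASSUMING `X` torsion, some `3^μ·L` lies in `(g₀·R₀⟦T⟧)` for a generator `g₀` of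
  `char X`, then (unconditionally) `∃ μ, span{3^μ·L} ≤ (char X).map toUnr`.
* `temperedHeegnerInclusionAtThree_of_temperedIndexBound` : **IB♮ → A** (no P).
* `temperedHeegnerInclusionAtThree_of_indexBoundOff` : **IB_off → A** (no P; IB_off = uniform constant, bounds required only
  at the primes `Q` coprime to one fixed `a ≠ 0` — Mazur–Rubin's finite exceptional set `Σ_Λ`).
* `temperedHeegnerInclusionAtThree_of_indexBound` : **IB → A** (no P).
* `temperedHeegnerInclusionAtThree_of_temperedDomination` : **A♮ → A** (no P); with the converse (p625563's
  `temperedDomination_of_temperedHeegnerInclusionAtThree`, re-proved inline): **A ⟺ A♮** exactly,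
  `temperedHeegnerInclusionAtThree_iff_temperedDomination`.
Imports: the route file and route-INDEPENDENT modules only (no Theorems-on-Theses cone).

So a line for crux 26896 composes as `26896 ⟸ (its research stubs) ⟹ IB♮` (or IB / IB_off / A♮ / the layer tower (LT) of p637184,
also print-free) with NO published input; P enters only at K1 (glue 26899, for `μ = 0` and saturation).

HONEST FRAMING: none of IB, IB_off, IB♮, A♮ is proved here; no class, reciprocity law or Selmer bound is constructed; A = crux 26896
and K1 = A + print stay OPEN. Theorems only; no named fact, no `sorry`, no new definition. BSD is not proved by any of this; no summit
statement is proved by this seat.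
-/

set_option linter.dupNamespace false
set_option autoImplicit false

noncomputable section

open scoped Classical Polynomial

namespace Summit.BirchSwinnertonDyer.BirchSwinnertonDyer.Theorems.CumulativeHeegnerInclusionAtThreePrintFreeDoors

open Literature.NumberTheory.EllipticCurves NumberField IsDedekindDomain Field
  Summit.BirchSwinnertonDyer.Rank1Residual.X11b Summit.BirchSwinnertonDyer.Rank1Residual.X11b.AcSelmer
  Summit.BirchSwinnertonDyer.BirchSwinnertonDyer.Theorems.CumulativeHeegnerInclusionAtThreeSpecialisationValues
  Summit.BirchSwinnertonDyer.BirchSwinnertonDyer.Theorems.CumulativeHeegnerInclusionAtThreeSpecialisationValuesTempered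
  Summit.BirchSwinnertonDyer.BirchSwinnertonDyer.Theorems.CumulativeHeegnerInclusionAtThreeUnrSeriesTemperedDomination
  Summit.BirchSwinnertonDyer.BirchSwinnertonDyer.Theorems.CumulativeHeegnerInclusionAtThreeUnrSeriesDomination

/-! ### §1 The case split on the torsion locus (pure `Λ`-module algebra) -/

/-- **Off/on the torsion locus.** Let `X` be a finitely generated `Λ = ℤ_3⟦T⟧`-module and `L ∈ R₀⟦T⟧`. Suppose that
WHENEVER `X` is `Λ`-torsion, for every generator `g₀ ≠ 0` of `char_Λ X` some `3^μ · L` lies in `(g₀ · R₀⟦T⟧)`. Then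
`∃ μ, span{3^μ · L} ≤ (char_Λ X).map toUnr` — with no torsion hypothesis: off the torsion locus `char_Λ X = ⊤`
(`charIdeal_eq_top_of_not_isTorsion`) and `μ = 0` serves; on it, `char_Λ X` is principal (`Λ` is a UFD) and non-zero.
[cite: Washington1997, §13.2 (characteristic ideal; junk off torsion)] -/
theorem exists_span_pow_mul_le_map_charIdeal_of_torsion_imp (X : Type*) [AddCommGroup X]
    [Module (IwasawaAlgebra 3) X] (L : UnrSeries 3)
    (h : Module.IsTorsion (IwasawaAlgebra 3) X → ∀ g₀ : IwasawaAlgebra 3,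
      Literature.NumberTheory.EllipticCurves.Module.charIdeal (IwasawaAlgebra 3) X = Ideal.span {g₀} → g₀ ≠ 0 →
        ∃ μ : ℕ, PowerSeries.C (((3 : ℕ) : unrIntegers 3) ^ μ) * L ∈
          Ideal.span {PowerSeries.map (Summit.BirchSwinnertonDyer.Rank1Residual.X11b.Halves.toUnr 3) g₀}) :
    ∃ μ : ℕ, Ideal.span {(3 : UnrSeries 3) ^ μ * L} ≤
      (Literature.NumberTheory.EllipticCurves.Module.charIdeal (IwasawaAlgebra 3) X).map
        (PowerSeries.map (Summit.BirchSwinnertonDyer.Rank1Residual.X11b.Halves.toUnr 3)) := by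
  by_cases hT : Module.IsTorsion (IwasawaAlgebra 3) X
  · -- a generator of `char X` in `Λ`
    obtain ⟨g₀, hg₀'⟩ := (charIdeal_isPrincipal_holds 3 X).principal
    have hg₀ : Literature.NumberTheory.EllipticCurves.Module.charIdeal (IwasawaAlgebra 3) X = Ideal.span {g₀} := by
      rw [hg₀', Ideal.submodule_span_eq]
    have hg0 : g₀ ≠ 0 := by
      intro h0
      apply Literature.NumberTheory.EllipticCurves.Module.charIdeal_ne_bot (IwasawaAlgebra 3) X
      rw [hg₀, h0, Ideal.span_singleton_eq_bot]
    obtain ⟨μ, hμ⟩ := h hT g₀ hg₀ hg0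
    refine ⟨μ, ?_⟩
    rw [hg₀, Ideal.map_span, Set.image_singleton, Ideal.span_singleton_le_iff_mem]
    have heq : (3 : UnrSeries 3) ^ μ * L = PowerSeries.C (((3 : ℕ) : unrIntegers 3) ^ μ) * L := by
      rw [map_pow, map_natCast]
      norm_cast
    rw [heq]
    exact hμ
  · exact ⟨0, Summit.BirchSwinnertonDyer.BirchSwinnertonDyer.Theorems.UniversalToricDescentCharIdealVacuity.span_le_map_charIdeal_of_not_isTorsion hT _ _⟩

/-! ### §2 IB♮ → A, IB_off → A, IB → A — no print -/

/-- **A ⟸ TEMPERED INDEX BOUND, print-free.** If at every frame of crux K1 the BDP function `L` satisfies the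
Kolyvagin-system-type bound in INDEX currency with radius-dependent constants (IB♮: for every `ρ < 1` some `C_ρ` and
`a_ρ ≠ 0` with `#(X_{∅,0}(𝔭′) ⧸ Q) · ‖L(y)‖^{deg Q} ≤ 3^{C_ρ·deg Q}` for every distinguished irreducible `Q` prime to `a_ρ`
and every root `y`, `‖y‖ ≤ ρ`), then A = crux stmt-26896 `TemperedHeegnerInclusionAtThree` holds — WITHOUT the print input
of p634963: torsion-ness of `X` is only needed on the torsion locus (§1). [cite: Washington1997, §13.2] -/
theorem temperedHeegnerInclusionAtThree_of_temperedIndexBound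
    (hIB : ∀ (W : WeierstrassCurve ℚ) [W.IsElliptic] [W.IsGloballyMinimal] (N : ℕ) [NeZero N] (K : Type) [Field K] [NumberField K] (Dt : Literature.NumberTheory.EllipticCurves.ModularForms.ModularParametrizationData W N), Summit.BirchSwinnertonDyer.Rank1Residual.Additive.ClassO6 W 3 → Literature.NumberTheory.EllipticCurves.Rank1Residual.Red W 3 → (∃ Φ : AddSubgroup (WeierstrassCurve.geomTorsion W ((3 : ℕ) : ℤ)), Literature.NumberTheory.EllipticCurves.Rank1Residual.IsRationalLine W 3 Φ ∧ ∀ (v : IsDedekindDomain.HeightOneSpectrum (NumberField.RingOfIntegers ℚ)), ((3 : ℕ) : NumberField.RingOfIntegers ℚ) ∈ v.asIdeal → ∀ 𝔓 ∈ v.primesAbove, ¬ (∀ g ∈ 𝔓.decompositionSubgroup (Field.absoluteGaloisGroup ℚ), ∀ P ∈ Φ, g • P = P) ∧ ¬ (∀ g ∈ 𝔓.decompositionSubgroup (Field.absoluteGaloisGroup ℚ), ∀ P : WeierstrassCurve.geomTorsion W ((3 : ℕ) : ℤ), g • P - P ∈ Φ)) → W.analyticRank = 1 → W.conductorNorm ℤ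 = N → Literature.NumberTheory.EllipticCurves.IsImaginaryQuadratic K → Literature.NumberTheory.EllipticCurves.SatisfiesHeegnerHypothesis N K → ∀ (κ : Literature.NumberTheory.EllipticCurves.ZpExtension K 3), κ.IsAnticyclotomic → ∀ (γ : Field.absoluteGaloisGroup K) [Fact (κ.IsTopGenerator γ)] (𝔭 : IsDedekindDomain.HeightOneSpectrum (NumberField.RingOfIntegers K)), ((3 : ℕ) : NumberField.RingOfIntegers K) ∈ 𝔭.asIdeal → 𝔭.asIdeal.ramificationIdx (NumberField.RingOfIntegers ℚ) = 1 → 𝔭.asIdeal.inertiaDeg (NumberField.RingOfIntegers ℚ) = 1 → ∀ (𝔭' : IsDedekindDomain.HeightOneSpectrum (NumberField.RingOfIntegers K)), ((3 : ℕ) : NumberField.RingOfIntegers K) ∈ 𝔭'.asIdeal → 𝔭' ≠ 𝔭 → ∀ (ι' : PadicAlgCl 3 ≃+* ℂ), Summit.BirchSwinnertonDyer.BirchSwinnertonDyer.Theorems.SchneiderFree.BranchInducesPrime 3 ι' 𝔭 → ∀ (ΩK : ℂ) (Ωp : ℂ_[3]) (L : Literature.NumberTheory.EllipticCurves.UnrSeries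 3), ΩK ≠ 0 → Ωp ≠ 0 → Literature.NumberTheory.EllipticCurves.IsBDPLFunction ι' 𝔭 κ γ Dt.f ΩK Ωp L → ∀ ρ : ℝ, ρ < 1 → ∃ (C : ℕ) (a : IwasawaAlgebra 3), a ≠ 0 ∧ ∀ Q : ℤ_[3][X], Q.IsDistinguishedAt (IsLocalRing.maximalIdeal ℤ_[3]) → Irreducible Q → IsRelPrime a (Q : IwasawaAlgebra 3) → ∀ y : PadicAlgCl 3, Polynomial.aeval y (Q.map (algebraMap ℤ_[3] ℚ_[3])) = 0 → ‖(y : ℂ_[3])‖ ≤ ρ → ∀ v : ℂ_[3], L.HasValueAt (y : ℂ_[3]) v → (Nat.card (Summit.BirchSwinnertonDyer.Rank1Residual.X11b.AcSelmer.XAc (W.baseChange K) 3 κ 𝔭' ∅ γ ⧸ (Ideal.span {(Q : IwasawaAlgebra 3)} • ⊤ : Submodule (IwasawaAlgebra 3) (Summit.BirchSwinnertonDyer.Rank1Residual.X11b.AcSelmer.XAc (W.baseChange K) 3 κ 𝔭' ∅ γ))) : ℝ) * ‖v‖ ^ Q.natDegree ≤ (3 : ℝ) ^ (C * Q.natDegree))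 :
    Summit.BirchSwinnertonDyer.BirchSwinnertonDyer.Theses.CumulativeHeegnerLeopoldt.TemperedHeegnerInclusionAtThree := by
  intro W _ _ N _ K _ _ Dt hO6 hRed hcell hr hN hK hHg κ hκ γ _ 𝔭 h𝔭 he hf 𝔭' h𝔭' hne ι' hι ΩK Ωp L hΩK hΩp hBDP
  haveI : (W.baseChange K).IsElliptic := inferInstanceAs (W.map (algebraMap ℚ K)).IsElliptic
  set X := XAc (W.baseChange K) 3 κ 𝔭' ∅ γ with hXdef
  haveI : Module.Finite (IwasawaAlgebra 3) X := XAc.module_finite_empty κ 𝔭' γ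
  have hC := hIB W N K Dt hO6 hRed hcell hr hN hK hHg κ hκ γ 𝔭 h𝔭 he hf 𝔭' h𝔭' hne ι' hι ΩK Ωp L hΩK hΩp hBDP
  refine exists_span_pow_mul_le_map_charIdeal_of_torsion_imp X L fun hT g₀ hg₀ hg0 => ?_
  exact exists_C_pow_mul_mem_span_of_card_quotSMulTop_le_tempered (p := 3) X hT hg₀ hg0 (L := L)
    (fun ρ hρ => by
      obtain ⟨C, a, ha, h⟩ := hC ρ hρ
      exact ⟨C, a, ha, fun Q hQ hirr _ haQ y hy hyρ v hv => h Q hQ hirr haQ y hy hyρ v hv⟩)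

/-- **A ⟸ INDEX BOUND OFF A FINITE EXCEPTIONAL SET, print-free.** IB_off — ONE constant `C` and ONE `a ∈ Λ ∖ {0}`, the bound
`#(X_{∅,0}(𝔭′) ⧸ Q) · ‖L(y)‖^{deg Q} ≤ 3^{C·deg Q}` being required only at the distinguished irreducible `Q` coprime to `a`
(Mazur–Rubin's finite set `Σ_Λ` of exceptional height-one primes) — implies A, with no print input: IB_off is IB♮ with constants
independent of the radius. [cite: Washington1997, §13.2] -/
theorem temperedHeegnerInclusionAtThree_of_indexBoundOff
    (hIB : ∀ (W : WeierstrassCurve ℚ) [W.IsElliptic] [W.IsGloballyMinimal] (N : ℕ) [NeZero N] (K : Type) [Field K] [NumberField K] (Dt : Literature.NumberTheory.EllipticCurves.ModularForms.ModularParametrizationData W N), Summit.BirchSwinnertonDyer.Rank1Residual.Additive.ClassO6 W 3 → Literature.NumberTheory.EllipticCurves.Rank1Residual.Red W 3 → (∃ Φ : AddSubgroup (WeierstrassCurve.geomTorsion W ((3 : ℕ) : ℤ)), Literature.NumberTheory.EllipticCurves.Rank1Residual.IsRationalLine W 3 Φ ∧ ∀ (v : IsDedekindDomain.HeightOneSpectrum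 (NumberField.RingOfIntegers ℚ)), ((3 : ℕ) : NumberField.RingOfIntegers ℚ) ∈ v.asIdeal → ∀ 𝔓 ∈ v.primesAbove, ¬ (∀ g ∈ 𝔓.decompositionSubgroup (Field.absoluteGaloisGroup ℚ), ∀ P ∈ Φ, g • P = P) ∧ ¬ (∀ g ∈ 𝔓.decompositionSubgroup (Field.absoluteGaloisGroup ℚ), ∀ P : WeierstrassCurve.geomTorsion W ((3 : ℕ) : ℤ), g • P - P ∈ Φ)) → W.analyticRank = 1 → W.conductorNorm ℤ = N → Literature.NumberTheory.EllipticCurves.IsImaginaryQuadratic K → Literature.NumberTheory.EllipticCurves.SatisfiesHeegnerHypothesis N K → ∀ (κ : Literature.NumberTheory.EllipticCurves.ZpExtension K 3), κ.IsAnticyclotomic → ∀ (γ : Field.absoluteGaloisGroup K) [Fact (κ.IsTopGenerator γ)] (𝔭 : IsDedekindDomain.HeightOneSpectrum (NumberField.RingOfIntegers K)), ((3 : ℕ) : NumberField.RingOfIntegers K) ∈ 𝔭.asIdeal → 𝔭.asIdeal.ramificationIdx (NumberField.RingOfIntegers ℚ) = 1 → 𝔭.asIdeal.inertiaDeg (NumberField.RingOfIntegers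 ℚ) = 1 → ∀ (𝔭' : IsDedekindDomain.HeightOneSpectrum (NumberField.RingOfIntegers K)), ((3 : ℕ) : NumberField.RingOfIntegers K) ∈ 𝔭'.asIdeal → 𝔭' ≠ 𝔭 → ∀ (ι' : PadicAlgCl 3 ≃+* ℂ), Summit.BirchSwinnertonDyer.BirchSwinnertonDyer.Theorems.SchneiderFree.BranchInducesPrime 3 ι' 𝔭 → ∀ (ΩK : ℂ) (Ωp : ℂ_[3]) (L : Literature.NumberTheory.EllipticCurves.UnrSeries 3), ΩK ≠ 0 → Ωp ≠ 0 → Literature.NumberTheory.EllipticCurves.IsBDPLFunction ι' 𝔭 κ γ Dt.f ΩK Ωp L → ∃ (C : ℕ) (a : IwasawaAlgebra 3), a ≠ 0 ∧ ∀ Q : ℤ_[3][X], Q.IsDistinguishedAt (IsLocalRing.maximalIdeal ℤ_[3]) → Irreducible Q → IsRelPrime a (Q : IwasawaAlgebra 3) → ∀ y : PadicAlgCl 3, Polynomial.aeval y (Q.map (algebraMap ℤ_[3] ℚ_[3])) = 0 → ∀ v : ℂ_[3], L.HasValueAt (y : ℂ_[3]) v → (Nat.card (Summit.BirchSwinnertonDyer.Rank1Residual.X11b.AcSelmer.XAc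 (W.baseChange K) 3 κ 𝔭' ∅ γ ⧸ (Ideal.span {(Q : IwasawaAlgebra 3)} • ⊤ : Submodule (IwasawaAlgebra 3) (Summit.BirchSwinnertonDyer.Rank1Residual.X11b.AcSelmer.XAc (W.baseChange K) 3 κ 𝔭' ∅ γ))) : ℝ) * ‖v‖ ^ Q.natDegree ≤ (3 : ℝ) ^ (C * Q.natDegree)) :
    Summit.BirchSwinnertonDyer.BirchSwinnertonDyer.Theses.CumulativeHeegnerLeopoldt.TemperedHeegnerInclusionAtThree := by
  refine temperedHeegnerInclusionAtThree_of_temperedIndexBound ?_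
  intro W _ _ N _ K _ _ Dt hO6 hRed hcell hr hN hK hHg κ hκ γ _ 𝔭 h𝔭 he hf 𝔭' h𝔭' hne ι' hι ΩK Ωp L hΩK hΩp hBDP
  obtain ⟨C, a, ha, h⟩ := hIB W N K Dt hO6 hRed hcell hr hN hK hHg κ hκ γ 𝔭 h𝔭 he hf 𝔭' h𝔭' hne ι' hι ΩK Ωp L hΩK hΩp hBDP
  intro ρ _
  exact ⟨C, a, ha, fun Q hQ hirr haQ y hy _ v hv => h Q hQ hirr haQ y hy v hv⟩

/-- **A ⟸ UNIFORM INDEX BOUND, print-free.** IB — one constant `C`, the bound at EVERY distinguished irreducible `Q` and every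
root (at the finitely many `Q ∣ char X` the quotient is infinite, `Nat.card = 0`, vacuous) — implies A with no print input
(print-free form of p635774's `temperedHeegnerInclusionAtThree_of_print_of_indexBound`): IB is IB_off with `a = 1`.
[cite: Washington1997, §13.2] -/
theorem temperedHeegnerInclusionAtThree_of_indexBound
    (hIB : ∀ (W : WeierstrassCurve ℚ) [W.IsElliptic] [W.IsGloballyMinimal] (N : ℕ) [NeZero N] (K : Type) [Field K] [NumberField K] (Dt : Literature.NumberTheory.EllipticCurves.ModularForms.ModularParametrizationData W N), Summit.BirchSwinnertonDyer.Rank1Residual.Additive.ClassO6 W 3 → Literature.NumberTheory.EllipticCurves.Rank1Residual.Red W 3 → (∃ Φ : AddSubgroup (WeierstrassCurve.geomTorsion W ((3 : ℕ) : ℤ)), Literature.NumberTheory.EllipticCurves.Rank1Residual.IsRationalLine W 3 Φ ∧ ∀ (v : IsDedekindDomain.HeightOneSpectrum (NumberField.RingOfIntegers ℚ)), ((3 : ℕ) : NumberField.RingOfIntegers ℚ) ∈ v.asIdeal → ∀ 𝔓 ∈ v.primesAbove, ¬ (∀ g ∈ 𝔓.decompositionSubgroup (Field.absoluteGaloisGroup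 ℚ), ∀ P ∈ Φ, g • P = P) ∧ ¬ (∀ g ∈ 𝔓.decompositionSubgroup (Field.absoluteGaloisGroup ℚ), ∀ P : WeierstrassCurve.geomTorsion W ((3 : ℕ) : ℤ), g • P - P ∈ Φ)) → W.analyticRank = 1 → W.conductorNorm ℤ = N → Literature.NumberTheory.EllipticCurves.IsImaginaryQuadratic K → Literature.NumberTheory.EllipticCurves.SatisfiesHeegnerHypothesis N K → ∀ (κ : Literature.NumberTheory.EllipticCurves.ZpExtension K 3), κ.IsAnticyclotomic → ∀ (γ : Field.absoluteGaloisGroup K) [Fact (κ.IsTopGenerator γ)] (𝔭 : IsDedekindDomain.HeightOneSpectrum (NumberField.RingOfIntegers K)), ((3 : ℕ) : NumberField.RingOfIntegers K) ∈ 𝔭.asIdeal → 𝔭.asIdeal.ramificationIdx (NumberField.RingOfIntegers ℚ) = 1 → 𝔭.asIdeal.inertiaDeg (NumberField.RingOfIntegers ℚ) = 1 → ∀ (𝔭' : IsDedekindDomain.HeightOneSpectrum (NumberField.RingOfIntegers K)), ((3 : ℕ) : NumberField.RingOfIntegers K) ∈ 𝔭'.asIdeal → 𝔭' ≠ 𝔭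 → ∀ (ι' : PadicAlgCl 3 ≃+* ℂ), Summit.BirchSwinnertonDyer.BirchSwinnertonDyer.Theorems.SchneiderFree.BranchInducesPrime 3 ι' 𝔭 → ∀ (ΩK : ℂ) (Ωp : ℂ_[3]) (L : Literature.NumberTheory.EllipticCurves.UnrSeries 3), ΩK ≠ 0 → Ωp ≠ 0 → Literature.NumberTheory.EllipticCurves.IsBDPLFunction ι' 𝔭 κ γ Dt.f ΩK Ωp L → ∃ C : ℕ, ∀ Q : ℤ_[3][X], Q.IsDistinguishedAt (IsLocalRing.maximalIdeal ℤ_[3]) → Irreducible Q → ∀ y : PadicAlgCl 3, Polynomial.aeval y (Q.map (algebraMap ℤ_[3] ℚ_[3])) = 0 → ∀ v : ℂ_[3], L.HasValueAt (y : ℂ_[3]) v → (Nat.card (Summit.BirchSwinnertonDyer.Rank1Residual.X11b.AcSelmer.XAc (W.baseChange K) 3 κ 𝔭' ∅ γ ⧸ (Ideal.span {(Q : IwasawaAlgebra 3)} • ⊤ : Submodule (IwasawaAlgebra 3) (Summit.BirchSwinnertonDyer.Rank1Residual.X11b.AcSelmer.XAc (W.baseChange K) 3 κ 𝔭' ∅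 γ))) : ℝ) * ‖v‖ ^ Q.natDegree ≤ (3 : ℝ) ^ (C * Q.natDegree)) :
    Summit.BirchSwinnertonDyer.BirchSwinnertonDyer.Theses.CumulativeHeegnerLeopoldt.TemperedHeegnerInclusionAtThree := by
  refine temperedHeegnerInclusionAtThree_of_indexBoundOff ?_
  intro W _ _ N _ K _ _ Dt hO6 hRed hcell hr hN hK hHg κ hκ γ _ 𝔭 h𝔭 he hf 𝔭' h𝔭' hne ι' hι ΩK Ωp L hΩK hΩp hBDP
  obtain ⟨C, h⟩ := hIB W N K Dt hO6 hRed hcell hr hN hK hHg κ hκ γ 𝔭 h𝔭 he hf 𝔭' h𝔭' hne ι' hι ΩK Ωp L hΩK hΩp hBDP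
  exact ⟨C, 1, one_ne_zero, fun Q hQ hirr _ y hy v hv => h Q hQ hirr y hy v hv⟩

/-! ### §3 A♮ → A — no print; A ⟺ A♮ -/

/-- **A ⟸ TEMPERED DOMINATION, print-free.** If at every frame of crux K1 the BDP function `L` is TEMPEREDLY dominated by
every generator `g` of `(Ch_Λ X_{∅,0}(𝔭′)).map toUnr` (constants `C_ρ` and finite exceptional sets `F_ρ` on each closed ball
`‖x‖ ≤ ρ < 1`) — the tempered-values form A♮ of memo TEMPERED-LINE-VIABILITY-g4 — then A holds, with no print input: the image
ideal is ALWAYS principal with a non-zero generator (`Λ` is a UFD, `char ≠ ⊥`, `toUnr` injective), and g4's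
`exists_span_pow_mul_le_of_norm_value_le_on_closedBalls` (p624927) applies. Converse = p625563's
`temperedDomination_of_temperedHeegnerInclusionAtThree`. [cite: Washington1997, §7.1 Thm. 7.3] -/
theorem temperedHeegnerInclusionAtThree_of_temperedDomination
    (hA : ∀ (W : WeierstrassCurve ℚ) [W.IsElliptic] [W.IsGloballyMinimal] (N : ℕ) [NeZero N] (K : Type) [Field K] [NumberField K] (Dt : Literature.NumberTheory.EllipticCurves.ModularForms.ModularParametrizationData W N), Summit.BirchSwinnertonDyer.Rank1Residual.Additive.ClassO6 W 3 → Literature.NumberTheory.EllipticCurves.Rank1Residual.Red W 3 → (∃ Φ : AddSubgroup (WeierstrassCurve.geomTorsion W ((3 : ℕ) : ℤ)), Literature.NumberTheory.EllipticCurves.Rank1Residual.IsRationalLine W 3 Φ ∧ ∀ (v : IsDedekindDomain.HeightOneSpectrum (NumberField.RingOfIntegers ℚ)), ((3 : ℕ) : NumberField.RingOfIntegers ℚ) ∈ v.asIdeal → ∀ 𝔓 ∈ v.primesAbove, ¬ (∀ g ∈ 𝔓.decompositionSubgroup (Field.absoluteGaloisGroup ℚ), ∀ P ∈ Φ, g •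 P = P) ∧ ¬ (∀ g ∈ 𝔓.decompositionSubgroup (Field.absoluteGaloisGroup ℚ), ∀ P : WeierstrassCurve.geomTorsion W ((3 : ℕ) : ℤ), g • P - P ∈ Φ)) → W.analyticRank = 1 → W.conductorNorm ℤ = N → Literature.NumberTheory.EllipticCurves.IsImaginaryQuadratic K → Literature.NumberTheory.EllipticCurves.SatisfiesHeegnerHypothesis N K → ∀ (κ : Literature.NumberTheory.EllipticCurves.ZpExtension K 3), κ.IsAnticyclotomic → ∀ (γ : Field.absoluteGaloisGroup K) [Fact (κ.IsTopGenerator γ)] (𝔭 : IsDedekindDomain.HeightOneSpectrum (NumberField.RingOfIntegers K)), ((3 : ℕ) : NumberField.RingOfIntegers K) ∈ 𝔭.asIdeal → 𝔭.asIdeal.ramificationIdx (NumberField.RingOfIntegers ℚ) = 1 → 𝔭.asIdeal.inertiaDeg (NumberField.RingOfIntegers ℚ) = 1 → ∀ (𝔭' : IsDedekindDomain.HeightOneSpectrum (NumberField.RingOfIntegers K)), ((3 : ℕ) : NumberField.RingOfIntegers K) ∈ 𝔭'.asIdeal → 𝔭' ≠ 𝔭 → ∀ (ι' : PadicAlgCl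 3 ≃+* ℂ), Summit.BirchSwinnertonDyer.BirchSwinnertonDyer.Theorems.SchneiderFree.BranchInducesPrime 3 ι' 𝔭 → ∀ (ΩK : ℂ) (Ωp : ℂ_[3]) (L : Literature.NumberTheory.EllipticCurves.UnrSeries 3), ΩK ≠ 0 → Ωp ≠ 0 → Literature.NumberTheory.EllipticCurves.IsBDPLFunction ι' 𝔭 κ γ Dt.f ΩK Ωp L → ∀ (g : Literature.NumberTheory.EllipticCurves.UnrSeries 3), (Summit.BirchSwinnertonDyer.Rank1Residual.X11b.AcSelmer.XAc.charIdeal (W.baseChange K) 3 κ 𝔭' ∅ γ).map (PowerSeries.map (Summit.BirchSwinnertonDyer.Rank1Residual.X11b.Halves.toUnr 3)) = Ideal.span {g} → ∀ ρ : ℝ, ρ < 1 → ∃ (F : Set ℂ_[3]) (C : ℝ), F.Finite ∧ ∀ x : ℂ_[3], x ∉ F → ‖x‖ ≤ ρ → ∀ u v : ℂ_[3], g.HasValueAt x u → L.HasValueAt x v → ‖v‖ ≤ C * ‖u‖) :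
    Summit.BirchSwinnertonDyer.BirchSwinnertonDyer.Theses.CumulativeHeegnerLeopoldt.TemperedHeegnerInclusionAtThree := by
  intro W _ _ N _ K _ _ Dt hO6 hRed hcell hr hN hK hHg κ hκ γ _ 𝔭 h𝔭 he hf 𝔭' h𝔭' hne ι' hι ΩK Ωp L hΩK hΩp hBDP
  haveI : (W.baseChange K).IsElliptic := inferInstanceAs (W.map (algebraMap ℚ K)).IsElliptic
  set X := XAc (W.baseChange K) 3 κ 𝔭' ∅ γ with hXdef
  -- a generator of `char X` in `Λ`, and its (non-zero) image in `R₀⟦T⟧`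
  obtain ⟨g₀, hg₀'⟩ := (charIdeal_isPrincipal_holds 3 X).principal
  have hg₀ : Literature.NumberTheory.EllipticCurves.Module.charIdeal (IwasawaAlgebra 3) X = Ideal.span {g₀} := by
    rw [hg₀', Ideal.submodule_span_eq]
  have hg0 : g₀ ≠ 0 := by
    intro h0
    apply Literature.NumberTheory.EllipticCurves.Module.charIdeal_ne_bot (IwasawaAlgebra 3) X
    rw [hg₀, h0, Ideal.span_singleton_eq_bot]
  set g : UnrSeries 3 := PowerSeries.map (Summit.BirchSwinnertonDyer.Rank1Residual.X11b.Halves.toUnr 3) g₀ with hgdef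
  have hg : g ≠ 0 := map_toUnr_ne_zero hg0
  have hmap : (XAc.charIdeal (W.baseChange K) 3 κ 𝔭' ∅ γ).map
      (PowerSeries.map (Summit.BirchSwinnertonDyer.Rank1Residual.X11b.Halves.toUnr 3)) = Ideal.span {g} := by
    rw [show XAc.charIdeal (W.baseChange K) 3 κ 𝔭' ∅ γ =
        Literature.NumberTheory.EllipticCurves.Module.charIdeal (IwasawaAlgebra 3) X from rfl, hg₀, Ideal.map_span,
      Set.image_singleton]
  have hdom := hA W N K Dt hO6 hRed hcell hr hN hK hHg κ hκ γ 𝔭 h𝔭 he hf 𝔭' h𝔭' hne ι' hι ΩK Ωp L hΩK hΩp hBDP g hmap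
  obtain ⟨μ, hμ⟩ := exists_span_pow_mul_le_of_norm_value_le_on_closedBalls (p := 3) hg
    (J := Ideal.span {g}) (Ideal.mem_span_singleton_self g) hdom
  refine ⟨μ, ?_⟩
  rw [hmap]
  have heq : (3 : UnrSeries 3) ^ μ * L = ((3 : ℕ) : UnrSeries 3) ^ μ * L := by norm_cast
  rw [heq]
  exact hμ

/-- **A ⟺ A♮** (ideal currency ⟺ tempered-values currency), no print: `→` is p625563's
`temperedDomination_of_temperedHeegnerInclusionAtThree`, `←` is `temperedHeegnerInclusionAtThree_of_temperedDomination`.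
[cite: Washington1997, §7.1 Thm. 7.3] -/
theorem temperedHeegnerInclusionAtThree_iff_temperedDomination :
    Summit.BirchSwinnertonDyer.BirchSwinnertonDyer.Theses.CumulativeHeegnerLeopoldt.TemperedHeegnerInclusionAtThree ↔
    (∀ (W : WeierstrassCurve ℚ) [W.IsElliptic] [W.IsGloballyMinimal] (N : ℕ) [NeZero N] (K : Type) [Field K] [NumberField K] (Dt : Literature.NumberTheory.EllipticCurves.ModularForms.ModularParametrizationData W N), Summit.BirchSwinnertonDyer.Rank1Residual.Additive.ClassO6 W 3 → Literature.NumberTheory.EllipticCurves.Rank1Residual.Red W 3 → (∃ Φ : AddSubgroup (WeierstrassCurve.geomTorsion W ((3 : ℕ) : ℤ)), Literature.NumberTheory.EllipticCurves.Rank1Residual.IsRationalLine W 3 Φ ∧ ∀ (v : IsDedekindDomain.HeightOneSpectrum (NumberField.RingOfIntegers ℚ)), ((3 : ℕ) : NumberField.RingOfIntegers ℚ) ∈ v.asIdeal → ∀ 𝔓 ∈ v.primesAbove, ¬ (∀ g ∈ 𝔓.decompositionSubgroup (Field.absoluteGaloisGroup ℚ), ∀ P ∈ Φ, g • P = P) ∧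 ¬ (∀ g ∈ 𝔓.decompositionSubgroup (Field.absoluteGaloisGroup ℚ), ∀ P : WeierstrassCurve.geomTorsion W ((3 : ℕ) : ℤ), g • P - P ∈ Φ)) → W.analyticRank = 1 → W.conductorNorm ℤ = N → Literature.NumberTheory.EllipticCurves.IsImaginaryQuadratic K → Literature.NumberTheory.EllipticCurves.SatisfiesHeegnerHypothesis N K → ∀ (κ : Literature.NumberTheory.EllipticCurves.ZpExtension K 3), κ.IsAnticyclotomic → ∀ (γ : Field.absoluteGaloisGroup K) [Fact (κ.IsTopGenerator γ)] (𝔭 : IsDedekindDomain.HeightOneSpectrum (NumberField.RingOfIntegers K)), ((3 : ℕ) : NumberField.RingOfIntegers K) ∈ 𝔭.asIdeal → 𝔭.asIdeal.ramificationIdx (NumberField.RingOfIntegers ℚ) = 1 → 𝔭.asIdeal.inertiaDeg (NumberField.RingOfIntegers ℚ) = 1 → ∀ (𝔭' : IsDedekindDomain.HeightOneSpectrum (NumberField.RingOfIntegers K)), ((3 : ℕ) : NumberField.RingOfIntegers K) ∈ 𝔭'.asIdeal → 𝔭' ≠ 𝔭 → ∀ (ι' : PadicAlgCl 3 ≃+*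 ℂ), Summit.BirchSwinnertonDyer.BirchSwinnertonDyer.Theorems.SchneiderFree.BranchInducesPrime 3 ι' 𝔭 → ∀ (ΩK : ℂ) (Ωp : ℂ_[3]) (L : Literature.NumberTheory.EllipticCurves.UnrSeries 3), ΩK ≠ 0 → Ωp ≠ 0 → Literature.NumberTheory.EllipticCurves.IsBDPLFunction ι' 𝔭 κ γ Dt.f ΩK Ωp L → ∀ (g : Literature.NumberTheory.EllipticCurves.UnrSeries 3), (Summit.BirchSwinnertonDyer.Rank1Residual.X11b.AcSelmer.XAc.charIdeal (W.baseChange K) 3 κ 𝔭' ∅ γ).map (PowerSeries.map (Summit.BirchSwinnertonDyer.Rank1Residual.X11b.Halves.toUnr 3)) = Ideal.span {g} → ∀ ρ : ℝ, ρ < 1 → ∃ (F : Set ℂ_[3]) (C : ℝ), F.Finite ∧ ∀ x : ℂ_[3], x ∉ F → ‖x‖ ≤ ρ → ∀ u v : ℂ_[3], g.HasValueAt x u → L.HasValueAt x v → ‖v‖ ≤ C * ‖u‖) :=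
by
  refine ⟨fun hA => ?_, temperedHeegnerInclusionAtThree_of_temperedDomination⟩
  -- `→` (= p625563's `temperedDomination_of_temperedHeegnerInclusionAtThree`, re-proved here to keep this file off the
  -- Theorems-on-Theses cone): an ideal inclusion `span{3^μ L} ≤ (g)` is UNIFORM domination with constant `3^μ`.
  intro W _ _ N _ K _ _ Dt hO6 hRed hcell hr hN hK hHg κ hκ γ _ 𝔭 h𝔭 he hf 𝔭' h𝔭' hne ι' hι ΩK Ωp L hΩK hΩp hBDP
    g hg ρ hρ
  obtain ⟨μ, hμ⟩ := hA W N K Dt hO6 hRed hcell hr hN hK hHg κ hκ γ 𝔭 h𝔭 he hf 𝔭' h𝔭' hne ι' hι ΩK Ωp L hΩK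
    hΩp hBDP
  rw [hg, Ideal.span_singleton_le_iff_mem] at hμ
  have hμ' : PowerSeries.C (((3 : ℕ) : unrIntegers 3) ^ μ) * L ∈ Ideal.span {g} := by
    have heq : ((3 : ℕ) : UnrSeries 3) ^ μ * L = PowerSeries.C (((3 : ℕ) : unrIntegers 3) ^ μ) * L := by
      rw [map_pow, map_natCast]
    rw [← heq]
    exact_mod_cast hμ
  refine ⟨∅, (3 : ℝ) ^ μ, Set.finite_empty, fun x _ hx u v hu hv ↦ ?_⟩
  exact_mod_cast norm_value_le_of_C_pow_mul_mem_span (p := 3) hμ' (lt_of_le_of_lt hx hρ) hu hv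

end Summit.BirchSwinnertonDyer.BirchSwinnertonDyer.Theorems.CumulativeHeegnerInclusionAtThreePrintFreeDoors

end
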